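import Summits.QuantumFields.YangMills.Theorems.FluctuationComparisonRegPrIntLS2BetaTreeGaugeChartTransversal
import Summits.QuantumFields.YangMills.Theorems.FluctuationComparisonRegPrIntLS2BetaExpChartOpen
import HarnessLib

/-!
# (C3) THE TUBULAR HAAR CHART OF A TREE GAUGE — FACTORISED EDITION (EXPORT (F1)(F2)(F3): product window, product density,
# openness at EVERY point of the window)

Crux `stmt-QuantumFields-20520` (`…Theses.UnitScaleTilt.FluctuationComparisonRegPrIntL`), LINE g18-1 S2β LAPLACE, organ (C3) ∕ row FOUR-POINT-DECAY;
cell `ym3-torus` (HUMAN RULING D-0037 — YM₃ on T³ is ladder rung R3, not the Clay problem), width seat `ym3-torus-px21` g11; count-neutral helper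
(`--kind proof --supports stmt-QuantumFields-20520 --as helper`).  Theorems only: 0 `def`, 0 `instance`, 0 `notation`, 0 `sorry`.

WHY.  w5-20520 g14's common-tube reading of the four corners of FOUR-POINT-DECAY (their (CT) door `…S2BetaLaplaceInstShift.laplaceLimit_of_charts_tendsto_shift`,
LIMIT-INST at a SHIFTED base point `y₁` of the transversal) consumes three facts that the landed generic chart
✓`…TreeGaugeChartTransversal.exists_tubularChart_of_treeGauge_transversal` (p741255) PROVES but does not EXPORT (its window `W` and density `J` are
existentially packaged, its openness row is stated at the origin only):
* (F1) the window is a PRODUCT `W = UZ ×ˢ UV` of open neighbourhoods of `0` in the two frames;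
* (F2) the density is a PRODUCT `J(z, y) = dZ z · dV y` of the two framed Haar-chart densities (continuous, `≥ 0`, positive at `0`) — so
  `∫_{ball ρ} J(z, y₁) dz = dV(y₁) · ∫_{ball ρ} dZ` and the orbit-direction factor is a corner-independent NUMBER;
* (F3) the tube map `Θ'(z, y) = (e z) • (σ y)` is OPEN AT EVERY POINT of `W` (not only at `(0,0)`): `∀ p ∈ W, ∀ s ∈ 𝓝 p, Θ' '' s ∈ 𝓝 (Θ' p)`.
This file is the generic edition `exists_tubularChart_of_treeGauge_factorised` = p741255's rows (smooth `σ`, σ-comb, σ-transporter, σ-growth, group chart,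
injectivity, origin openness, chart identity) with `∃ e σ UZ UV dZ dV` in place of `∃ e σ W J` and (F1)(F2)(F3) added.  Same construction
(`Θ' = Ξ ∘ L_{(w₀,u₀)} ∘ (Θ^{ι∖R}∘eZ × Θ^{β∖F}∘eV)`), same proof; the one new ingredient is this seat's ✓`…S2BetaExpChartOpen`: THE FRAMED EXPONENTIAL CHART
IS OPEN AT EVERY POINT OF THE CHART BALL (`Θ|_{B(0,s_C)}` is a homeomorphism onto the open canonical window), packaged as
`exists_haarChart_expChart_frame_open` (the lit framed Haar chart with that row).
HONEST SCOPE.  Point-set topology of the exponential chart and measure bookkeeping; nothing of Bałaban's analysis; (CT) ∕ FOUR-POINT-DECAY ∕ LAPLACE ∕ S2β ∕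
stmt-QuantumFields-20520 are NOT proved here; rung R3 = YM₃ on T³ — NOT d = 4, NOT infinite volume, NOT a mass gap, NOT Clay.
[cite: Helgason2000, Ch. I §1 Thm 1.14 (13) p.96; Balaban1985Averaging, (8), (10) p.18; Balaban1985Variational, (19) p.281, Thm 1 (10) p.279;
Balaban1985UV3, p.260]
-/

noncomputable section

open MeasureTheory MeasureTheory.Measure Set Function Filter Topology
open scoped ENNReal
open Literature.MathematicalPhysics.QuantumFieldTheory.Balaban1983to89
open Literature.MathematicalPhysics.QuantumFieldTheory.Balaban1983to89.HaarExponentialChart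
open Literature.MathematicalPhysics.QuantumFieldTheory.Balaban1983to89.LogChartProduct
open Literature.Analysis.Asymptotics

namespace Summit.QuantumFields.YangMills.Theorems.FluctuationComparisonRegPrIntLS2BetaTreeGaugeChartFactorised

open Summit.QuantumFields.YangMills.Theorems.FluctuationComparisonRegPrIntLS2BetaTreeGaugeAlgebra
open Summit.QuantumFields.YangMills.Theorems.FluctuationComparisonRegPrIntLS2BetaTreeGaugeHaar
open Summit.QuantumFields.YangMills.Theorems.FluctuationComparisonRegPrIntLS2BetaTreeGaugeChartTransversal
  (exists_sq_norm_le_sum_norm_exp_sub_one_sq)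
open Summit.QuantumFields.YangMills.Theorems.FluctuationComparisonRegPrIntLS2BetaExpChartOpen (exists_haarChart_expChart_frame_open)

variable {𝔸 : Type*} [NormedRing 𝔸] [NormedAlgebra ℂ 𝔸] [CompleteSpace 𝔸]
variable {G : Type*} [Group G] [TopologicalSpace G] [IsTopologicalGroup G] [CompactSpace G] [T2Space G]
  [MeasurableSpace G] [BorelSpace G] [SecondCountableTopology G]
variable {C : LogChart 𝔸} {ρ : G →* 𝔸} (h : IsChartRep C ρ) [FiniteDimensional ℝ C.lie]
  (hlie : ∀ x ∈ C.lie, ∀ y ∈ C.lie, x * y - y * x ∈ C.lie)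
variable (μG : Measure G) [μG.IsHaarMeasure] [IsProbabilityMeasure μG]
variable {ι β : Type*} [Fintype ι] [Fintype β]
  (s t : β → ι) (R : Set ι) [DecidablePred (· ∈ R)] (F : Set β) [DecidablePred (· ∈ F)]
  (g : (β → G) → (ι → G))
variable [MeasurableSpace (piLogChart C {x // x ∉ R}).lie] [BorelSpace (piLogChart C {x // x ∉ R}).lie]
variable [MeasurableSpace (piLogChart C {b // b ∉ F}).lie] [BorelSpace (piLogChart C {b // b ∉ F}).lie]
variable {Z : Type*} [NormedAddCommGroup Z] [InnerProductSpace ℝ Z] [FiniteDimensional ℝ Z] [MeasurableSpace Z] [BorelSpace Z]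
  (eZ : Z ≃L[ℝ] (piLogChart C {x // x ∉ R}).lie)
variable {V : Type*} [NormedAddCommGroup V] [InnerProductSpace ℝ V] [FiniteDimensional ℝ V] [MeasurableSpace V] [BorelSpace V]
  (eV : V ≃L[ℝ] (piLogChart C {b // b ∉ F}).lie)

set_option maxHeartbeats 400000 in
include h hlie eZ eV in
/-- ★★★ **THE TUBULAR HAAR CHART OF A TREE GAUGE — FACTORISED EDITION** (generic assembly; every row of the transversal edition
✓`exists_tubularChart_of_treeGauge_transversal` — smooth `σ`, (σ-comb), (σ-transporter), (σ-growth), the root-trivial group chart onto a neighbourhood of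
`1`, injectivity, openness at the origin, the chart identity — with the window and the density EXPORTED IN PRODUCT FORM: (F1) `W = UZ ×ˢ UV`, `UZ ∋ 0`,
`UV ∋ 0` open; (F2) `J(z,y) = dZ z · dV y`, `dZ, dV` continuous, `≥ 0`, positive at `0`; and (F3) the tube map is OPEN AT EVERY POINT of `UZ ×ˢ UV`;
see the module docstring for the setting and the construction).
[cite: Helgason2000, Ch. I §1 Thm 1.14 (13) p. 96; HasenpflugRudolfSprungk2024, §3.1 Assumption 3 (T); Balaban1985Averaging, (8), (10) p.18;
Balaban1985Variational, (19) p.281, Thm 1 (10) p.279] -/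
theorem exists_tubularChart_of_treeGauge_factorised (hgc : Continuous g) (hgR : ∀ V, ∀ r ∈ R, g V r = 1)
    (hcov : ∀ (a : ι → G), (∀ r ∈ R, a r = 1) → ∀ (V : β → G) (x : ι),
      g (fun b => a (s b) * V b * (a (t b))⁻¹) x = g V x * (a x)⁻¹)
    (hkill : ∀ V, ∀ b ∈ F, g V (s b) * V b * (g V (t b))⁻¹ = 1)
    (hloc : ∀ V V' : β → G, (∀ b ∈ F, V b = V' b) → g V = g V') (hg1 : g (fun _ => 1) = fun _ => 1)
    (U₀ : β → G) :
    ∃ (e : Z → (ι → G)) (σ : V → (β → G)) (UZ : Set Z) (UV : Set V) (dZ : Z → ℝ) (dV : V → ℝ),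
      Continuous e ∧ e 0 = 1 ∧ (∀ z, ∀ r ∈ R, e z r = 1) ∧
      (∀ sZ ∈ 𝓝 (0 : Z), ∃ tt ∈ 𝓝 (1 : ι → G), ∀ w ∈ tt, (∀ r ∈ R, w r = 1) → w ∈ e '' sZ) ∧
      Continuous σ ∧ σ 0 = U₀ ∧ ContDiff ℝ ⊤ (fun y : V => fun b : β => (ρ (σ y b) : 𝔸)) ∧
      (∀ y, ∀ b ∈ F, σ y b = U₀ b) ∧ (∀ y, g (σ y) = g U₀) ∧
      (∃ c : ℝ, 0 < c ∧ ∀ᶠ y in 𝓝 (0 : V), c * ‖y‖ ^ 2 ≤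
        ∑ b : {b // b ∉ F}, ‖ρ ((g U₀ (s b) * U₀ b * (g U₀ (t b))⁻¹)⁻¹ * (g (σ y) (s b) * σ y b * (g (σ y) (t b))⁻¹)) - 1‖ ^ 2) ∧
      IsOpen UZ ∧ IsOpen UV ∧ (0 : Z) ∈ UZ ∧ (0 : V) ∈ UV ∧
      InjOn (fun p : Z × V => fun b : β => e p.1 (s b) * σ p.2 b * (e p.1 (t b))⁻¹) (UZ ×ˢ UV) ∧
      (∀ sW ∈ 𝓝 ((0 : Z), (0 : V)), (fun p : Z × V => fun b : β => e p.1 (s b) * σ p.2 b * (e p.1 (t b))⁻¹) '' sW ∈ 𝓝 U₀) ∧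
      (∀ p ∈ UZ ×ˢ UV, ∀ sW ∈ 𝓝 p, (fun p : Z × V => fun b : β => e p.1 (s b) * σ p.2 b * (e p.1 (t b))⁻¹) '' sW ∈
        𝓝 ((fun p : Z × V => fun b : β => e p.1 (s b) * σ p.2 b * (e p.1 (t b))⁻¹) p)) ∧
      Continuous dZ ∧ Continuous dV ∧ (∀ z, 0 ≤ dZ z) ∧ (∀ y, 0 ≤ dV y) ∧ 0 < dZ 0 ∧ 0 < dV 0 ∧
      (Measure.pi fun _ : β => μG).restrict ((fun p : Z × V => fun b : β => e p.1 (s b) * σ p.2 b * (e p.1 (t b))⁻¹) '' (UZ ×ˢ UV)) =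
        ((((volume : Measure Z).prod (volume : Measure V)).restrict (UZ ×ˢ UV)).withDensity
            (fun w => ENNReal.ofReal (dZ w.1 * dV w.2))).map
          (fun p : Z × V => fun b : β => e p.1 (s b) * σ p.2 b * (e p.1 (t b))⁻¹) := by
  classical
  haveI := finiteDimensional_piLogChart_lie C {x // x ∉ R}
  haveI := finiteDimensional_piLogChart_lie C {b // b ∉ F}
  -- the two factor groups, their Haar measures and framed exponential charts
  set hR := isChartRep_pi {x // x ∉ R} h with hhR
  set hF := isChartRep_pi {b // b ∉ F} h with hhF
  set νR : Measure ({x // x ∉ R} → G) := Measure.pi fun _ => μG with hνR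
  set νF : Measure ({b // b ∉ F} → G) := Measure.pi fun _ => μG with hνF
  obtain ⟨UZ, dZ, hUZo, h0Z, hinjZ, hoZ, hdZc, hdZ0, hdZpos, hchartZ⟩ :=
    exists_haarChart_expChart_frame_open hR (lie_adStable_pi C {x // x ∉ R} hlie) νR eZ
  obtain ⟨UV, dV, hUVo, h0V, hinjV, hoV, hdVc, hdV0, hdVpos, hchartV⟩ :=
    exists_haarChart_expChart_frame_open hF (lie_adStable_pi C {b // b ∉ F} hlie) νF eV
  set τZ : Z → ({x // x ∉ R} → G) := fun z => hR.expChart (eZ z) with hτZ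
  set τV : V → ({b // b ∉ F} → G) := fun y => hF.expChart (eV y) with hτV
  have hτZc : Continuous τZ := hR.continuous_expChart.comp eZ.continuous
  have hτVc : Continuous τV := hF.continuous_expChart.comp eV.continuous
  have hτZ0 : τZ 0 = 1 := by simp only [hτZ, map_zero, IsChartRep.expChart_zero]
  have hτV0 : τV 0 = 1 := by simp only [hτV, map_zero, IsChartRep.expChart_zero]
  -- the tree-gauge maps
  set Ξ : ({x // x ∉ R} → G) × ({b // b ∉ F} → G) → (β → G) := fun p => fun b : β =>
      (fun x : ι => if hx : x ∈ R then (1 : G) else p.1 ⟨x, hx⟩) (s b) *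
        (fun b : β => if hb : b ∈ F then (1 : G) else p.2 ⟨b, hb⟩) b *
        ((fun x : ι => if hx : x ∈ R then (1 : G) else p.1 ⟨x, hx⟩) (t b))⁻¹ with hΞ_def
  set Ψ : (β → G) → ({x // x ∉ R} → G) × ({b // b ∉ F} → G) := fun V =>
    ((fun x : {x // x ∉ R} => (g V x)⁻¹), (fun b : {b // b ∉ F} => g V (s b) * V b * (g V (t b))⁻¹)) with hΨ_def
  have hΞΨ : ∀ V, Ξ (Ψ V) = V := fun V => xi_psi s t R F g hgR hkill V
  have hΨΞ : ∀ p, Ψ (Ξ p) = p := fun p => psi_xi s t R F g hcov hloc hg1 p.1 p.2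
  have hΞc : Continuous Ξ := continuous_xi (G := G) s t R F
  have hΞmp : MeasurePreserving Ξ (νR.prod νF) (Measure.pi fun _ : β => μG) :=
    measurePreserving_xi μG s t R F g hgc.measurable hgR hcov hkill hloc
  -- `Ξ` is a homeomorphism (continuous bijection, compact → Hausdorff)
  set ΞE : (({x // x ∉ R} → G) × ({b // b ∉ F} → G)) ≃ (β → G) :=
    { toFun := Ξ, invFun := Ψ, left_inv := hΨΞ, right_inv := hΞΨ } with hΞE
  set ΞH : (({x // x ∉ R} → G) × ({b // b ∉ F} → G)) ≃ₜ (β → G) := Continuous.homeoOfEquivCompactToT2 (f := ΞE) hΞc with hΞH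
  have hΞH_apply : ∀ p, ΞH p = Ξ p := fun p => rfl
  -- the base point in tree coordinates
  set w₀ : {x // x ∉ R} → G := (Ψ U₀).1 with hw₀
  set u₀ : {b // b ∉ F} → G := (Ψ U₀).2 with hu₀
  have hq₀ : Ψ U₀ = (w₀, u₀) := rfl
  -- the chart maps
  set ext : ({x // x ∉ R} → G) → (ι → G) := fun w x => if hx : x ∈ R then (1 : G) else w ⟨x, hx⟩ with hext
  have hext_mul : ∀ w w' : {x // x ∉ R} → G, ext (w * w') = ext w * ext w' := by
    intro w w'; funext x; by_cases hx : x ∈ R <;> simp [hext, hx]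
  have hext_one : ext 1 = 1 := by funext x; by_cases hx : x ∈ R <;> simp [hext, hx]
  have hext_R : ∀ w, ∀ r ∈ R, ext w r = 1 := fun w r hr => by simp [hext, hr]
  have hextc : Continuous ext := by
    refine continuous_pi fun x => ?_
    by_cases hx : x ∈ R
    · simp only [hext, dif_pos hx]; exact continuous_const
    · simp only [hext, dif_neg hx]; exact continuous_apply _
  set e : Z → (ι → G) := fun z => ext w₀ * ext (τZ z) * (ext w₀)⁻¹ with he_def
  set σ : V → (β → G) := fun y => Ξ (w₀, u₀ * τV y) with hσ_def
  set Θ' : Z × V → (β → G) := fun p => fun b : β => e p.1 (s b) * σ p.2 b * (e p.1 (t b))⁻¹ with hΘ'_def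
  -- KEY IDENTITY: `Θ' = Ξ ∘ ((w₀,u₀) · ) ∘ (τZ × τV)`
  have hkey : ∀ p : Z × V, Θ' p = Ξ ((w₀, u₀) * (τZ p.1, τV p.2)) := by
    intro p
    funext b
    simp only [hΘ'_def, he_def, hσ_def, hΞ_def, Prod.mk_mul_mk, Pi.mul_apply, Pi.inv_apply, hext]
    by_cases hs : s b ∈ R <;> by_cases ht : t b ∈ R <;> by_cases hb : b ∈ F
    all_goals simp [hs, ht, hb]
    all_goals group
  -- the window
  set W : Set (Z × V) := UZ ×ˢ UV with hW
  refine ⟨e, σ, UZ, UV, dZ, dV, ?_, ?_, ?_, ?_, ?_, ?_, ?_, ?_, ?_, ?_, hUZo, hUVo, h0Z, h0V, ?_, ?_, ?_,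
    hdZc, hdVc, hdZ0, hdV0, hdZpos, hdVpos, ?_⟩
  · -- `e` continuous
    exact ((continuous_const.mul (hextc.comp hτZc)).mul continuous_const)
  · -- `e 0 = 1`
    simp only [he_def, hτZ0, hext_one, mul_one, mul_inv_cancel]
  · -- root-trivial
    intro z r hr
    simp only [he_def, Pi.mul_apply, Pi.inv_apply, hext_R _ r hr, mul_one, mul_inv_cancel]
  · -- `e` is onto a neighbourhood of `1` among the root-trivial transformations
    intro sZ hsZ
    have h1 : τZ '' sZ ∈ 𝓝 (1 : {x // x ∉ R} → G) :=
      nhds_one_le_map_expChart_frame hR eZ (Filter.image_mem_map hsZ)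
    -- conjugate by `w₀` and pull back along the restriction map
    set cj : ({x // x ∉ R} → G) ≃ₜ ({x // x ∉ R} → G) := (Homeomorph.mulLeft w₀).trans (Homeomorph.mulRight w₀⁻¹) with hcj
    have hc1 : cj 1 = 1 := by
      simp only [hcj, Homeomorph.trans_apply, Homeomorph.coe_mulLeft, Homeomorph.coe_mulRight, mul_one, mul_inv_cancel]
    have h2 : cj '' (τZ '' sZ) ∈ 𝓝 (1 : {x // x ∉ R} → G) := by
      have := cj.isOpenMap.image_mem_nhds h1
      rwa [hc1] at this
    set rest : (ι → G) → ({x // x ∉ R} → G) := fun w x => w x with hrest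
    have hrestc : Continuous rest := continuous_pi fun x => continuous_apply _
    have hrest1 : rest 1 = 1 := rfl
    refine ⟨rest ⁻¹' (cj '' (τZ '' sZ)), hrestc.continuousAt.preimage_mem_nhds (by rw [hrest1]; exact h2), ?_⟩
    intro w hw hwR
    obtain ⟨v, ⟨z, hz, rfl⟩, hv⟩ := hw
    refine ⟨z, hz, ?_⟩
    funext x
    by_cases hx : x ∈ R
    · simp only [he_def, Pi.mul_apply, Pi.inv_apply, hext_R _ x hx, mul_one, mul_inv_cancel, hwR x hx]
    · have hvx := congrFun hv ⟨x, hx⟩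
      simp only [hcj, Homeomorph.trans_apply, Homeomorph.coe_mulLeft, Homeomorph.coe_mulRight, hrest] at hvx
      simp only [he_def, Pi.mul_apply, Pi.inv_apply, hext, dif_neg hx]
      simpa using hvx
  · -- `σ` continuous
    exact hΞc.comp (continuous_const.prodMk (continuous_const.mul hτVc))
  · -- `σ 0 = U₀`
    simp only [hσ_def, hτV0, mul_one]
    rw [← hq₀]; exact hΞΨ U₀
  · -- `σ` is smooth through `ρ`: bondwise `const · exp(linear) · const` in `𝔸`
    have hexp : ContDiff ℝ ⊤ (NormedSpace.exp : 𝔸 → 𝔸) :=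
      contDiff_iff_contDiffAt.2 fun x => (NormedSpace.exp_analytic (𝕂 := ℝ) x).contDiffAt
    refine contDiff_pi.2 fun b => ?_
    have hσb : ∀ y : V, ρ (σ y b) = ρ (ext w₀ (s b)) *
        ρ ((fun b : β => if hb : b ∈ F then (1 : G) else (u₀ * τV y) ⟨b, hb⟩) b) * ρ ((ext w₀ (t b))⁻¹) := by
      intro y; simp only [hσ_def, hΞ_def, hext, map_mul]
    rw [show (fun y : V => ρ (σ y b)) = fun y => ρ (ext w₀ (s b)) *
        ρ ((fun b : β => if hb : b ∈ F then (1 : G) else (u₀ * τV y) ⟨b, hb⟩) b) * ρ ((ext w₀ (t b))⁻¹) from funext hσb]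
    refine (contDiff_const.mul ?_).mul contDiff_const
    by_cases hb : b ∈ F
    · simp only [dif_pos hb, map_one]; exact contDiff_const
    · simp only [dif_neg hb, Pi.mul_apply, map_mul]
      refine contDiff_const.mul ?_
      -- `ρ (τV y ⟨b, hb⟩) = exp (a linear function of y)`
      set L : V →ₗ[ℝ] 𝔸 := C.lie.subtype ∘ₗ (LinearMap.proj (R := ℝ) (φ := fun _ : {b // b ∉ F} => C.lie) ⟨b, hb⟩ ∘ₗ
        ((lieEquivPi C {b // b ∉ F}).toLinearMap ∘ₗ (eV : V ≃L[ℝ] (piLogChart C {b // b ∉ F}).lie).toLinearEquiv.toLinearMap)) with hL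
      have hρτ : (fun y : V => ρ (τV y ⟨b, hb⟩)) = fun y => NormedSpace.exp (LinearMap.toContinuousLinearMap L y) := by
        funext y
        show ρ ((isChartRep_pi {b // b ∉ F} h).expChart (eV y) ⟨b, hb⟩) = _
        rw [expChart_pi_apply (B := {b // b ∉ F}) h, h.rho_expChart]
        rfl
      rw [hρτ]
      exact hexp.comp (LinearMap.toContinuousLinearMap L).contDiff
  · -- (σ-comb) the transversal moves no comb bond
    intro y b hb
    have hU₀ : Ξ (w₀, u₀) = U₀ := by rw [← hq₀]; exact hΞΨ U₀
    rw [← congrFun hU₀ b]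
    simp only [hσ_def, hΞ_def, dif_pos hb]
  · -- (σ-transporter) the transporter is constant along the transversal: `Ψ(σ y).1 = w₀ = Ψ(U₀).1`
    intro y
    have hΨσ : Ψ (σ y) = (w₀, u₀ * τV y) := hΨΞ (w₀, u₀ * τV y)
    funext x
    by_cases hx : x ∈ R
    · rw [hgR _ x hx, hgR _ x hx]
    · have h1 : (g (σ y) x)⁻¹ = w₀ ⟨x, hx⟩ := by
        have := congrFun (congrArg Prod.fst hΨσ) ⟨x, hx⟩
        simpa only [hΨ_def] using this
      have h2 : (g U₀ x)⁻¹ = w₀ ⟨x, hx⟩ := rfl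
      exact inv_injective (h1.trans h2.symm)
  · -- (σ-growth) in the free-bond tree coordinates the transversal IS the exponential chart: `(Ψ U₀).2⁻¹ · (Ψ (σ y)).2 = Θ^{β∖F}(eV y)`
    obtain ⟨c, hc, hev⟩ := exists_sq_norm_le_sum_norm_exp_sub_one_sq C eV
    refine ⟨c, hc, ?_⟩
    filter_upwards [hev] with y hy
    have hΨσ : Ψ (σ y) = (w₀, u₀ * τV y) := hΨΞ (w₀, u₀ * τV y)
    have hterm : ∀ b : {b // b ∉ F},
        ρ ((g U₀ (s b) * U₀ b * (g U₀ (t b))⁻¹)⁻¹ * (g (σ y) (s b) * σ y b * (g (σ y) (t b))⁻¹)) =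
          NormedSpace.exp (((eV y : (piLogChart C {b // b ∉ F}).lie) : {b // b ∉ F} → 𝔸) b) := by
      intro b
      have h1 : g (σ y) (s b) * σ y b * (g (σ y) (t b))⁻¹ = u₀ b * τV y b := by
        have := congrFun (congrArg Prod.snd hΨσ) b
        simpa only [hΨ_def, Pi.mul_apply] using this
      have h2 : g U₀ (s b) * U₀ b * (g U₀ (t b))⁻¹ = u₀ b := rfl
      rw [h1, h2, ← mul_assoc, inv_mul_cancel, one_mul]
      show ρ ((isChartRep_pi {b // b ∉ F} h).expChart (eV y) b) = _
      rw [expChart_pi_apply (B := {b // b ∉ F}) h, h.rho_expChart]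
      rfl
    calc c * ‖y‖ ^ 2 ≤ _ := hy
      _ = _ := Finset.sum_congr rfl fun b _ => by rw [hterm b]
  · -- injectivity on the window
    intro p hp p' hp' hpp
    have h1 : Ξ ((w₀, u₀) * (τZ p.1, τV p.2)) = Ξ ((w₀, u₀) * (τZ p'.1, τV p'.2)) := by
      rw [← hkey, ← hkey]; exact hpp
    have h2 := mul_left_cancel (ΞE.injective h1)
    simp only [Prod.mk.injEq] at h2
    exact Prod.ext (hinjZ hp.1 hp'.1 h2.1) (hinjV hp.2 hp'.2 h2.2)
  · -- openness at the origin
    intro sW hsW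
    have hτ : (fun p : Z × V => (τZ p.1, τV p.2)) '' sW ∈ 𝓝 ((1 : {x // x ∉ R} → G), (1 : {b // b ∉ F} → G)) := by
      have hle : 𝓝 ((1 : {x // x ∉ R} → G), (1 : {b // b ∉ F} → G)) ≤
          map (fun p : Z × V => (τZ p.1, τV p.2)) (𝓝 ((0 : Z), (0 : V))) := by
        rw [nhds_prod_eq, nhds_prod_eq, ← Filter.prod_map_map_eq]
        exact Filter.prod_mono (nhds_one_le_map_expChart_frame hR eZ) (nhds_one_le_map_expChart_frame hF eV)
      exact hle (Filter.image_mem_map hsW)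
    have hL : (fun q => (w₀, u₀) * q) '' ((fun p : Z × V => (τZ p.1, τV p.2)) '' sW) ∈ 𝓝 ((w₀, u₀) : ({x // x ∉ R} → G) × ({b // b ∉ F} → G)) := by
      have := (Homeomorph.mulLeft ((w₀, u₀) : ({x // x ∉ R} → G) × ({b // b ∉ F} → G))).isOpenMap.image_mem_nhds hτ
      simpa using this
    have hΞo : Ξ '' ((fun q => (w₀, u₀) * q) '' ((fun p : Z × V => (τZ p.1, τV p.2)) '' sW)) ∈ 𝓝 (Ξ (w₀, u₀)) := by
      have := ΞH.isOpenMap.image_mem_nhds hL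
      simpa [hΞH_apply] using this
    have hU₀ : Ξ (w₀, u₀) = U₀ := by rw [← hq₀]; exact hΞΨ U₀
    rw [hU₀] at hΞo
    refine Filter.mem_of_superset hΞo ?_
    rintro _ ⟨_, ⟨_, ⟨p, hp, rfl⟩, rfl⟩, rfl⟩
    exact ⟨p, hp, hkey p⟩
  · -- (F3) openness at EVERY point of the window: the two framed exponential charts are open on `UZ` ∕ `UV` (✓`…ExpChartOpen`), then translate and `Ξ`
    rintro p ⟨hpZ, hpV⟩ sW hsW
    obtain ⟨N1, hN1, N2, hN2, hsub⟩ := mem_nhds_prod_iff.1 hsW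
    have h1 : τZ '' N1 ∈ 𝓝 (τZ p.1) := hoZ p.1 hpZ N1 hN1
    have h2 : τV '' N2 ∈ 𝓝 (τV p.2) := hoV p.2 hpV N2 hN2
    have hτ : (fun p : Z × V => (τZ p.1, τV p.2)) '' sW ∈ 𝓝 (τZ p.1, τV p.2) := by
      refine Filter.mem_of_superset (prod_mem_nhds h1 h2) ?_
      rintro ⟨a, b⟩ ⟨⟨z, hz, rfl⟩, ⟨y, hy, rfl⟩⟩
      exact ⟨(z, y), hsub (Set.mk_mem_prod hz hy), rfl⟩
    have hL : (fun q => (w₀, u₀) * q) '' ((fun p : Z × V => (τZ p.1, τV p.2)) '' sW) ∈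
        𝓝 (((w₀, u₀) : ({x // x ∉ R} → G) × ({b // b ∉ F} → G)) * (τZ p.1, τV p.2)) := by
      have := (Homeomorph.mulLeft ((w₀, u₀) : ({x // x ∉ R} → G) × ({b // b ∉ F} → G))).isOpenMap.image_mem_nhds hτ
      simpa using this
    have hΞo : Ξ '' ((fun q => (w₀, u₀) * q) '' ((fun p : Z × V => (τZ p.1, τV p.2)) '' sW)) ∈
        𝓝 (Ξ (((w₀, u₀) : ({x // x ∉ R} → G) × ({b // b ∉ F} → G)) * (τZ p.1, τV p.2))) := by
      have := ΞH.isOpenMap.image_mem_nhds hL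
      simpa [hΞH_apply] using this
    show Θ' '' sW ∈ 𝓝 (Θ' p)
    rw [hkey p]
    refine Filter.mem_of_superset hΞo ?_
    rintro _ ⟨_, ⟨_, ⟨q, hq, rfl⟩, rfl⟩, rfl⟩
    exact ⟨q, hq, hkey q⟩
  · -- THE CHART IDENTITY
    haveI : (νR.prod νF).IsMulLeftInvariant := inferInstance
    -- (1) the product of the two frame charts
    have hτm : Measurable (fun p : Z × V => (τZ p.1, τV p.2)) := (hτZc.prodMap hτVc).measurable
    have hdZm : Measurable fun z => ENNReal.ofReal (dZ z) := ENNReal.measurable_ofReal.comp hdZc.measurable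
    have hdVm : Measurable fun y => ENNReal.ofReal (dV y) := ENNReal.measurable_ofReal.comp hdVc.measurable
    have hprod : (νR.prod νF).restrict ((fun p : Z × V => (τZ p.1, τV p.2)) '' W) =
        ((((volume : Measure Z).prod (volume : Measure V)).restrict W).withDensity
            (fun w => ENNReal.ofReal (dZ w.1 * dV w.2))).map
          (fun p : Z × V => (τZ p.1, τV p.2)) := by
      have himg : (fun p : Z × V => (τZ p.1, τV p.2)) '' W = (τZ '' UZ) ×ˢ (τV '' UV) := by
        rw [hW]; exact Set.prodMap_image_prod τZ τV UZ UV
      rw [himg, ← Measure.prod_restrict, hchartZ, hchartV,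
        Measure.map_prod_map _ _ hτZc.measurable hτVc.measurable,
        prod_withDensity hdZm hdVm, Measure.prod_restrict, ← hW]
      congr 1
      refine withDensity_congr_ae (Filter.Eventually.of_forall fun p => ?_)
      show ENNReal.ofReal (dZ p.1) * ENNReal.ofReal (dV p.2) = ENNReal.ofReal (dZ p.1 * dV p.2)
      rw [ENNReal.ofReal_mul (hdZ0 _)]
    -- (2) left translation in the product group is Haar-preserving and a measurable embedding
    have hLmp : MeasurePreserving (fun q => ((w₀, u₀) : ({x // x ∉ R} → G) × ({b // b ∉ F} → G)) * q) (νR.prod νF) (νR.prod νF) :=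
      measurePreserving_mul_left _ _
    have hLemb : MeasurableEmbedding (fun q => ((w₀, u₀) : ({x // x ∉ R} → G) × ({b // b ∉ F} → G)) * q) :=
      (Homeomorph.mulLeft ((w₀, u₀) : ({x // x ∉ R} → G) × ({b // b ∉ F} → G))).measurableEmbedding
    have hL := (hLmp.restrict_image_emb hLemb ((fun p : Z × V => (τZ p.1, τV p.2)) '' W)).map_eq
    -- (3) `Ξ` is measure preserving and a measurable embedding (homeomorphism)
    have hΞemb : MeasurableEmbedding Ξ := by
      have hco : (ΞH : (({x // x ∉ R} → G) × ({b // b ∉ F} → G)) → (β → G)) = Ξ := funext hΞH_apply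
      rw [← hco]
      exact ΞH.measurableEmbedding
    have hX := (hΞmp.restrict_image_emb hΞemb
      ((fun q => ((w₀, u₀) : ({x // x ∉ R} → G) × ({b // b ∉ F} → G)) * q) '' ((fun p : Z × V => (τZ p.1, τV p.2)) '' W))).map_eq
    -- assemble
    have hΘ'eq : Θ' = Ξ ∘ (fun q => ((w₀, u₀) : ({x // x ∉ R} → G) × ({b // b ∉ F} → G)) * q) ∘ (fun p : Z × V => (τZ p.1, τV p.2)) := by
      funext p; exact hkey p
    have himg3 : Θ' '' W = Ξ '' ((fun q => ((w₀, u₀) : ({x // x ∉ R} → G) × ({b // b ∉ F} → G)) * q) '' ((fun p : Z × V => (τZ p.1, τV p.2)) '' W)) := by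
      rw [hΘ'eq, Set.image_comp, Set.image_comp]
    show (Measure.pi fun _ : β => μG).restrict (Θ' '' W) =
      ((((volume : Measure Z).prod (volume : Measure V)).restrict W).withDensity (fun w => ENNReal.ofReal (dZ w.1 * dV w.2))).map Θ'
    rw [himg3, ← hX, ← hL, hprod, Measure.map_map hLemb.measurable hτm, Measure.map_map hΞemb.measurable (hLemb.measurable.comp hτm), hΘ'eq]

end Summit.QuantumFields.YangMills.Theorems.FluctuationComparisonRegPrIntLS2BetaTreeGaugeChartFactorised

end
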